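import Summits.ValiantsHypothesis.ValiantsHypothesis.Theorems.KPlusLogSqLawTropicalBTopHeavyCoreGeneral

/-!
# Route «KPlusLogSqLaw», crux `TropicalB` (stmt-ValiantsHypothesis-19771) — THE ONE-COLUMN TRANSFER LAW, BUDGET FORM (sharp):
# the raised column need not dominate `P_A`; it only has to pay for the jump (`d (λA x) + d c₀ ≤ d (λB x) + d (λB b)` off `b`)

HONEST FRAMING.  Sharpening of this seat's `TopHeavyCore.core_law_general` (…TopHeavyCoreGeneral; val-sym-trop-p1 g21, cell `pub-symmetroid`,
2026-08-28; `--supports stmt-ValiantsHypothesis-19771 --as helper`).  Same proof, read once more for what it uses: the hypothesis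
`d (λA ·) ≤ d (λB b)` («the raised column dominates all of `P_A`») enters only at the jump column `j` of the one-jump transversal, where the
deficit `d (λA j) − d (λB j)` must be covered by the surplus `d (λB b) − d c₀` at the column `b ∉ U`; and the global minimality of `d c₀` enters
only through the classes of the three terms.  So both are replaced by the BUDGET `d (λA x) + d c₀ ≤ d (λB x) + d (λB b)` for `x ≠ b` and
`d c₀ ≤ d (λC ·)`.  LOCATED AS SHARP on the concave family `{c₂^m, c₁ c₃^{m−1}, c₀^{m−1} c₄}` (sequel file …TopHeavyCoreConcave): with the budget
`d c₃ + d c₀ ≤ 2·d c₂` ktight finds the core infeasible `8/8` at each of `m = 3, 4, 5`, without it FEASIBLE `8/8` at each (tools/coreConc.py of the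
deposit HOME/val-sym-trop-p1/g21/).  A structure law about dominance designs of every size `m ≥ 2`; nothing here bears on `TropicalB` in its
window, `WeakLifting`, DoorA26 / DoorA34, `MatrixDescartes` (stmt-ValiantsHypothesis-18050) or VP ≠ VNP.

* `fin3_cases_two` — `Fin 3` bookkeeping.
* `core_of_arc_budget` — the 3-body assembly under the budget hypotheses (one-jump transversal + `LexCore.two_factor` + `latin_contra_sum`).
* `core_law_budget` — the law given `σA⁻¹σB b ≠ b`.
* `core_law_transfer` — **THE ONE-COLUMN TRANSFER LAW, BUDGET FORM**: `P_C` latest with `λC ≡ c₀` off one column and `d c₀ ≤ d (λC ·)`,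
  `d c₀ < d (λA ·)`, `d c₀ < d (λB ·)`; `d (λB x) ≤ d (λA x)` and `d (λA x) + d c₀ ≤ d (λB x) + d (λB b)` for `x ≠ b`; `d (λA b) < d (λB b)`; the two
  terms differ at a second column ⇒ `False`.  `core_law_general` is the case `d (λA ·) ≤ d (λB b)`, `d c₀` minimal.
[this cell; combinatorics folklore]
-/

set_option linter.dupNamespace false
set_option autoImplicit false

namespace Summit.ValiantsHypothesis.ValiantsHypothesis.Theorems.KPlusLogSqLaw.TopHeavyCore

open Summit.ValiantsHypothesis.ValiantsHypothesis.Theorems.MatrixDescartes.Negative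
open Summit.ValiantsHypothesis.ValiantsHypothesis.Theorems.KPlusLogSqLaw.LexCore
open scoped BigOperators
open Finset

variable {m K : ℕ}

/-! ## 1. The 3-body assembly under the budget hypotheses -/

/-- `Fin 3` bookkeeping: two distinct non-`2` slots and `2` exhaust `Fin 3`. -/
theorem fin3_cases_two (iA iB : Fin 3) (hA : iA ≠ 2) (hB : iB ≠ 2) (hAB : iA ≠ iB) (s : Fin 3) : s = iA ∨ s = iB ∨ s = 2 := by
  revert iA iB s; decide


/-- **BUDGET CORE, GIVEN THE ARC.**  `P_C` latest with `λC ≡ c₀` off the column `c`, `d c₀ ≤ d (λC ·)` and `d c₀` strictly below all exponents of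
`λA`, `λB`; `P_B ≤ P_A` in exponent off the column `b`, the budget `d (λA x) + d c₀ ≤ d (λB x) + d (λB b)` off `b`, `d (λA b) < d (λB b)`; one-jump arc data `(U, j)` (`c, j ∈ U`, `b ∉ U ∖ {j}`, `U ≠ univ`, the map
«`σC` off `U`, `σB` on `U ∖ {j}`, `σA` at `j`» injective).  Then `False`. [this cell] -/
theorem core_of_arc_budget (d : Fin K → ℕ) (v ε : Fin m → Fin m → Fin K → ℤ) (hm : 2 ≤ m)
    {c₀ : Fin K} {σA σB σC : Equiv.Perm (Fin m)} {lA lB lC : Fin m → Fin K} {b c : Fin m}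
    (hlC : ∀ x, x ≠ c → lC x = c₀) (hCge : ∀ x, d c₀ ≤ d (lC x)) (hlowA : ∀ x, d c₀ < d (lA x)) (hlowB : ∀ x, d c₀ < d (lB x))
    (hBA : ∀ x, x ≠ b → d (lB x) ≤ d (lA x)) (hdef : ∀ x, x ≠ b → d (lA x) + d c₀ ≤ d (lB x) + d (lB b)) (hltb : d (lA b) < d (lB b))
    {θA θB θC : ℤ} (hA : IsDominant d v ε θA (σA, lA)) (hB : IsDominant d v ε θB (σB, lB)) (hC : IsDominant d v ε θC (σC, lC))
    (hAC : θA < θC) (hBC : θB < θC) (hAB : θA ≠ θB)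
    (U : Finset (Fin m)) (j : Fin m) (hjU : j ∈ U) (hcU : c ∈ U) (hbU : b ∉ U ∨ b = j) (hUne : U ≠ univ)
    (hinj : Function.Injective fun x => if x ∈ U then (if x = j then σA x else σB x) else σC x) : False := by
  classical
  -- a column outside `U`
  obtain ⟨x₀, hx₀⟩ : ∃ x, x ∉ U := by
    by_contra h; push Not at h; exact hUne (Finset.eq_univ_of_forall h)
  -- quotients against `C` are fixed-point free
  have hfA := (hamiltonian_AC d v ε hAC hA hC c (c₀ := c₀) hlC hlowA hm).1
  have hfB := (hamiltonian_AC d v ε hBC hB hC c (c₀ := c₀) hlC hlowB hm).1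
  have hCA : ∀ x, σC x ≠ σA x := fun x h => hfA x (by
    rw [Equiv.Perm.mul_apply, Equiv.Perm.inv_eq_iff_eq]; exact h)
  have hCB : ∀ x, σC x ≠ σB x := fun x h => hfB x (by
    rw [Equiv.Perm.mul_apply, Equiv.Perm.inv_eq_iff_eq]; exact h)
  -- order the three terms: `T 2 = C`, `T iA = A`, `T iB = B`
  obtain ⟨iA, iB, T, θ3, hT2, hTA, hTB, hiA2, hiB2, hiAB, hθ01, hθ12, hdomT, -, -⟩ :
      ∃ (iA iB : Fin 3) (T : Fin 3 → Equiv.Perm (Fin m) × (Fin m → Fin K)) (θ3 : Fin 3 → ℤ),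
        T 2 = (σC, lC) ∧ T iA = (σA, lA) ∧ T iB = (σB, lB) ∧ iA ≠ 2 ∧ iB ≠ 2 ∧ iA ≠ iB ∧ θ3 0 < θ3 1 ∧ θ3 1 < θ3 2 ∧
        (∀ k, IsDominant d v ε (θ3 k) (T k)) ∧ θ3 iA = θA ∧ θ3 iB = θB := by
    rcases lt_or_gt_of_ne hAB with hlt | hgt
    · refine ⟨0, 1, ![(σA, lA), (σB, lB), (σC, lC)], ![θA, θB, θC], rfl, rfl, rfl, by decide, by decide, by decide, ?_, ?_, ?_, rfl, rfl⟩
      · simpa using hlt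
      · simpa using hBC
      · intro k; fin_cases k <;> simpa
    · refine ⟨1, 0, ![(σB, lB), (σA, lA), (σC, lC)], ![θB, θA, θC], rfl, rfl, rfl, by decide, by decide, by decide, ?_, ?_, ?_, rfl, rfl⟩
      · simpa using hgt
      · simpa using hAC
      · intro k; fin_cases k <;> simpa
  -- the selector of the one-jump transversal
  let s₀ : Fin m → Fin 3 := fun x => if x ∈ U then (if x = j then iA else iB) else 2
  have hs₀row : ∀ x, (T (s₀ x)).1 x = (if x ∈ U then (if x = j then σA x else σB x) else σC x) := by
    intro x
    by_cases hx : x ∈ U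
    · by_cases hxj : x = j
      · simp only [s₀, if_pos hx, if_pos hxj, hTA]
      · simp only [s₀, if_pos hx, if_neg hxj, hTB]
    · simp only [s₀, if_neg hx, hT2]
  have hs₀cls : ∀ x, (T (s₀ x)).2 x = (if x ∈ U then (if x = j then lA x else lB x) else lC x) := by
    intro x
    by_cases hx : x ∈ U
    · by_cases hxj : x = j
      · simp only [s₀, if_pos hx, if_pos hxj, hTA]
      · simp only [s₀, if_pos hx, if_neg hxj, hTB]
    · simp only [s₀, if_neg hx, hT2]
  have hi₀ : Function.Injective fun x => (T (s₀ x)).1 x := by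
    have : (fun x => (T (s₀ x)).1 x) = fun x => if x ∈ U then (if x = j then σA x else σB x) else σC x := funext hs₀row
    rw [this]; exact hinj
  -- rows of the three terms are injective
  have hr : ∀ s, Function.Injective fun x => (T s).1 x := fun s => (T s).1.injective
  -- Kőnig: split the free incidences
  obtain ⟨s₁', s₂', h1M, h2M, h12', hi₁', hi₂'⟩ := LexCore.two_factor (fun s x => (T s).1 x) hr s₀ hi₀
  -- arrange that the second free transversal takes `C`'s cell at column `c`
  obtain ⟨s₁, s₂, h01s, h02s, h12s, hi₁, hi₂, hs₂c⟩ : ∃ s₁ s₂ : Fin m → Fin 3, (∀ x, s₀ x ≠ s₁ x) ∧ (∀ x, s₀ x ≠ s₂ x) ∧ (∀ x, s₁ x ≠ s₂ x) ∧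
      Function.Injective (fun x => (T (s₁ x)).1 x) ∧ Function.Injective (fun x => (T (s₂ x)).1 x) ∧ s₂ c = 2 := by
    have hs₀c : s₀ c ≠ 2 := by
      simp only [s₀, if_pos hcU]; split_ifs <;> assumption
    by_cases h2 : s₂' c = 2
    · exact ⟨s₁', s₂', fun x => (h1M x).symm, fun x => (h2M x).symm, h12', hi₁', hi₂', h2⟩
    · have h1 : s₁' c = 2 := fin3_third (s₀ c) (s₁' c) (s₂' c) (h1M c) (h2M c) (h12' c) hs₀c h2
      exact ⟨s₂', s₁', fun x => (h2M x).symm, fun x => (h1M x).symm, fun x => (h12' x).symm, hi₂', hi₁', h1⟩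
  -- `Q₀ ≠ T 0` at the column `x₀ ∉ U`
  have hneQ : ∃ x, (T (s₀ x)).1 x ≠ (T 0).1 x := by
    refine ⟨x₀, ?_⟩
    rw [hs₀row x₀, if_neg hx₀]
    have h0 : (0 : Fin 3) = iA ∨ (0 : Fin 3) = iB := fin3_zero iA iB hiA2 hiB2 hiAB
    rcases h0 with h | h
    · rw [h, hTA]; exact hCA x₀
    · rw [h, hTB]; exact hCB x₀
  -- exponents of `Q₀` off `U` are `d c₀`
  have hoff : ∀ x, x ∉ U → (d ((T (s₀ x)).2 x) : ℤ) = d c₀ := by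
    intro x hx
    have hxc : x ≠ c := fun h => hx (h ▸ hcU)
    rw [hs₀cls x, if_neg hx, hlC x hxc]
  have honj : (d ((T (s₀ j)).2 j) : ℤ) = d (lA j) := by rw [hs₀cls j, if_pos hjU, if_pos rfl]
  have hon : ∀ x, x ∈ U → x ≠ j → (d ((T (s₀ x)).2 x) : ℤ) = d (lB x) := by
    intro x hx hxj; rw [hs₀cls x, if_pos hx, if_neg hxj]
  have hb' : ∀ x, x ∈ U → x ≠ j → x ≠ b := by
    intro x hx hxj hxb; rcases hbU with h | h
    · exact h (hxb ▸ hx)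
    · exact hxj (hxb.trans h)
  -- domination of `Q₀` by the earliest term, in sum
  have hP1 : ∑ x, (d ((T (s₀ x)).2 x) : ℤ) ≤ ∑ x, (d ((T 0).2 x) : ℤ) := by
    have h0 : (0 : Fin 3) = iA ∨ (0 : Fin 3) = iB := fin3_zero iA iB hiA2 hiB2 hiAB
    rcases h0 with h | h
    · -- earliest term is `A`: pointwise domination
      rw [h, hTA]
      refine Finset.sum_le_sum fun x _ => ?_
      by_cases hx : x ∈ U
      · by_cases hxj : x = j
        · rw [hxj, honj]
        · rw [hon x hx hxj]; exact_mod_cast hBA x (hb' x hx hxj)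
      · rw [hoff x hx]; exact_mod_cast (hlowA x).le
    · -- earliest term is `B`
      rw [h, hTB]
      by_cases hjb : j = b
      · -- `Q₀` is pointwise dominated by `B` as well
        refine Finset.sum_le_sum fun x _ => ?_
        by_cases hx : x ∈ U
        · by_cases hxj : x = j
          · rw [hxj, honj]
            change (d (lA j) : ℤ) ≤ (d (lB j) : ℤ)
            rw [hjb]; exact_mod_cast hltb.le
          · rw [hon x hx hxj]
        · rw [hoff x hx]; exact_mod_cast (hlowB x).le
      · -- `b ∉ U`: compare outside the two columns `j`, `b` pointwise, and at `{j, b}` jointly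
        have hbU' : b ∉ U := by rcases hbU with h' | h'; exact h'; exact absurd h'.symm hjb
        have hjb' : j ≠ b := hjb
        have splitQ := Finset.add_sum_erase (univ : Finset (Fin m)) (fun x => (d ((T (s₀ x)).2 x) : ℤ)) (Finset.mem_univ j)
        have splitB := Finset.add_sum_erase (univ : Finset (Fin m)) (fun x => (d (lB x) : ℤ)) (Finset.mem_univ j)
        have hbmem : b ∈ (univ : Finset (Fin m)).erase j := Finset.mem_erase.mpr ⟨hjb'.symm, Finset.mem_univ b⟩
        have splitQ' := Finset.add_sum_erase ((univ : Finset (Fin m)).erase j) (fun x => (d ((T (s₀ x)).2 x) : ℤ)) hbmem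
        have splitB' := Finset.add_sum_erase ((univ : Finset (Fin m)).erase j) (fun x => (d (lB x) : ℤ)) hbmem
        have hrest : ∑ x ∈ ((univ : Finset (Fin m)).erase j).erase b, (d ((T (s₀ x)).2 x) : ℤ) ≤
            ∑ x ∈ ((univ : Finset (Fin m)).erase j).erase b, (d (lB x) : ℤ) := by
          refine Finset.sum_le_sum fun x hx => ?_
          have hxj : x ≠ j := Finset.ne_of_mem_erase (Finset.mem_of_mem_erase hx)
          by_cases hxU : x ∈ U
          · rw [hon x hxU hxj]
          · rw [hoff x hxU]; exact_mod_cast (hlowB x).le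
        have hQj : (d ((T (s₀ j)).2 j) : ℤ) + d c₀ ≤ d (lB j) + d (lB b) := by rw [honj]; exact_mod_cast hdef j hjb'
        have hQb : (d ((T (s₀ b)).2 b) : ℤ) = d c₀ := hoff b hbU'
        show ∑ x, (d ((T (s₀ x)).2 x) : ℤ) ≤ ∑ x, (d ((σB, lB).2 x) : ℤ)
        simp only
        linarith
  -- domination of the last term by the transversal through `C`'s cell at `c`, pointwise
  have hP2 : ∑ x, (d ((T 2).2 x) : ℤ) ≤ ∑ x, (d ((T (s₂ x)).2 x) : ℤ) := by
    refine Finset.sum_le_sum fun x _ => ?_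
    rw [hT2]
    by_cases hxc : x = c
    · subst hxc; rw [hs₂c, hT2]
    · simp only
      rw [hlC x hxc]
      rcases fin3_cases_two iA iB hiA2 hiB2 hiAB (s₂ x) with h | h | h
      · rw [h, hTA]; exact_mod_cast (hlowA x).le
      · rw [h, hTB]; exact_mod_cast (hlowB x).le
      · rw [h, hT2]; exact_mod_cast hCge x
  exact latin_contra_sum d v ε T θ3 hθ01 hθ12 hdomT s₀ s₁ s₂ h01s h02s h12s hi₀ hi₁ hi₂ hneQ hP1 hP2

/-! ## 2. The law given that `b` is moved; the transfer law -/

/-- **BUDGET CORE, GIVEN `σA⁻¹σB b ≠ b`.**  The hypotheses of `core_of_arc_budget` on the three terms, plus `b` moved by `σA⁻¹σB`: the one-jump arc exists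
(`exists_arcFamily`, `exists_arc`) and its transversal is injective, so `False`. [this cell] -/
theorem core_law_budget (d : Fin K → ℕ) (v ε : Fin m → Fin m → Fin K → ℤ) (hm : 2 ≤ m)
    {c₀ : Fin K} {σA σB σC : Equiv.Perm (Fin m)} {lA lB lC : Fin m → Fin K} {b c : Fin m}
    (hlC : ∀ x, x ≠ c → lC x = c₀) (hCge : ∀ x, d c₀ ≤ d (lC x)) (hlowA : ∀ x, d c₀ < d (lA x)) (hlowB : ∀ x, d c₀ < d (lB x))
    (hBA : ∀ x, x ≠ b → d (lB x) ≤ d (lA x)) (hdef : ∀ x, x ≠ b → d (lA x) + d c₀ ≤ d (lB x) + d (lB b)) (hltb : d (lA b) < d (lB b))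
    {θA θB θC : ℤ} (hA : IsDominant d v ε θA (σA, lA)) (hB : IsDominant d v ε θB (σB, lB)) (hC : IsDominant d v ε θC (σC, lC))
    (hAC : θA < θC) (hBC : θB < θC) (hAB : θA ≠ θB) (hb : (σA⁻¹ * σB) b ≠ b) : False := by
  classical
  -- the quotient against `C`
  obtain ⟨hfixBC, hcycBC⟩ := hamiltonian_AC d v ε hBC hB hC c (c₀ := c₀) hlC hlowB hm
  set P : Equiv.Perm (Fin m) := σC⁻¹ * σB with hPdef
  have hPinv : P = (σB⁻¹ * σC)⁻¹ := by rw [hPdef, mul_inv_rev, inv_inv]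
  have hfix : ∀ x, P x ≠ x := by
    intro x h
    apply hfixBC x
    rw [Equiv.Perm.mul_apply, Equiv.Perm.inv_eq_iff_eq]
    rw [hPdef, Equiv.Perm.mul_apply, Equiv.Perm.inv_eq_iff_eq] at h
    exact h.symm
  have hcyc : ∀ x y, P.SameCycle x y := by
    intro x y
    rw [hPinv, Equiv.Perm.sameCycle_inv]
    exact (hcycBC x).symm.trans (hcycBC y)
  set τ : Equiv.Perm (Fin m) := σA⁻¹ * σB with hτdef
  -- the one-jump arc
  obtain ⟨Uf, hUF⟩ := exists_arcFamily P τ hfix hcyc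
  obtain ⟨j, hj, hcU, hbU⟩ := exists_arc P τ hfix hcyc Uf hUF b c hb
  obtain ⟨hjU, hfirst, hcard, hstart, hstep, -, -⟩ := hUF j hj
  set U := Uf j with hUdef
  have hUne : U ≠ univ := by
    intro h
    have := hcard
    rw [h, card_univ, Fintype.card_fin] at this
    exact lt_irrefl _ this
  -- the transversal's row map, through `σC`
  have hτinv : ∀ x, τ⁻¹ x = σB⁻¹ (σA x) := fun x => by rw [hτdef, mul_inv_rev, inv_inv, Equiv.Perm.mul_apply]
  have hPB : ∀ x, σC (P x) = σB x := fun x => by rw [hPdef, Equiv.Perm.mul_apply]; simp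
  have hQA : σC (P (τ⁻¹ j)) = σA j := by rw [hPB, hτinv]; simp
  let g : Fin m → Fin m := fun x => if x ∈ U then (if x = j then P (τ⁻¹ j) else P x) else x
  have hfg : ∀ x, (if x ∈ U then (if x = j then σA x else σB x) else σC x) = σC (g x) := by
    intro x
    by_cases hx : x ∈ U
    · by_cases hxj : x = j
      · simp only [g, if_pos hx, if_pos hxj]; rw [hxj, hQA]
      · simp only [g, if_pos hx, if_neg hxj]; rw [hPB]
    · simp only [g, if_neg hx]
  have hgU : ∀ x, x ∈ U → g x ∈ U := by
    intro x hx
    by_cases hxj : x = j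
    · simp only [g, if_pos hx, if_pos hxj]; exact hfirst
    · simp only [g, if_pos hx, if_neg hxj]; exact hstep x hx hxj
  have hgU' : ∀ x, x ∉ U → g x = x := fun x hx => by simp only [g, if_neg hx]
  have hginj : Function.Injective g := by
    intro x y hxy
    by_cases hx : x ∈ U
    · by_cases hy : y ∈ U
      · by_cases hxj : x = j
        · by_cases hyj : y = j
          · rw [hxj, hyj]
          · exfalso
            have e : P (τ⁻¹ j) = P y := by simpa only [g, if_pos hx, if_pos hxj, if_pos hy, if_neg hyj] using hxy
            have : τ⁻¹ j = y := P.injective e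
            exact hstart (this ▸ hy)
        · by_cases hyj : y = j
          · exfalso
            have e : P x = P (τ⁻¹ j) := by simpa only [g, if_pos hx, if_neg hxj, if_pos hy, if_pos hyj] using hxy
            have : x = τ⁻¹ j := P.injective e
            exact hstart (this ▸ hx)
          · have e : P x = P y := by simpa only [g, if_pos hx, if_neg hxj, if_pos hy, if_neg hyj] using hxy
            exact P.injective e
      · exfalso; apply hy; rw [← hgU' y hy, ← hxy]; exact hgU x hx
    · by_cases hy : y ∈ U
      · exfalso; apply hx; rw [← hgU' x hx, hxy]; exact hgU y hy
      · rw [← hgU' x hx, ← hgU' y hy, hxy]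
  have hinj : Function.Injective fun x => if x ∈ U then (if x = j then σA x else σB x) else σC x := by
    intro x y hxy
    have : σC (g x) = σC (g y) := by rw [← hfg x, ← hfg y]; exact hxy
    exact hginj (σC.injective this)
  exact core_of_arc_budget d v ε hm hlC hCge hlowA hlowB hBA hdef hltb hA hB hC hAC hBC hAB U j hjU hcU hbU hUne hinj

/-- **THE ONE-COLUMN TRANSFER LAW, BUDGET FORM.**  For every format `(m, K)`, `m ≥ 2`: no design has three dominant terms `P_A = (σA, λA)`,
`P_B = (σB, λB)`, `P_C = (σC, λC)` with `P_C` the latest such that `λC ≡ c₀` off one column, `d c₀ ≤ d (λC ·)`, `d c₀ < d (λA ·)`, `d c₀ < d (λB ·)`;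
`d (λB x) ≤ d (λA x)` and `d (λA x) + d c₀ ≤ d (λB x) + d (λB b)` for `x ≠ b`; `d (λA b) < d (λB b)`; and `P_A`, `P_B` differ at some column `x ≠ b`.
[this cell] -/
theorem core_law_transfer (d : Fin K → ℕ) (v ε : Fin m → Fin m → Fin K → ℤ) (hm : 2 ≤ m)
    {c₀ : Fin K} {σA σB σC : Equiv.Perm (Fin m)} {lA lB lC : Fin m → Fin K} {b c x : Fin m}
    (hlC : ∀ x, x ≠ c → lC x = c₀) (hCge : ∀ x, d c₀ ≤ d (lC x)) (hlowA : ∀ x, d c₀ < d (lA x)) (hlowB : ∀ x, d c₀ < d (lB x))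
    (hBA : ∀ x, x ≠ b → d (lB x) ≤ d (lA x)) (hdef : ∀ x, x ≠ b → d (lA x) + d c₀ ≤ d (lB x) + d (lB b)) (hltb : d (lA b) < d (lB b))
    (hxb : x ≠ b) (hdiff : σA x ≠ σB x ∨ lA x ≠ lB x)
    {θA θB θC : ℤ} (hA : IsDominant d v ε θA (σA, lA)) (hB : IsDominant d v ε θB (σB, lB)) (hC : IsDominant d v ε θC (σC, lC))
    (hAC : θA < θC) (hBC : θB < θC) : False := by
  -- `P_A ≠ P_B` (their classes differ at `b`), so `θA ≠ θB`
  have hABne : ((σA, lA) : Equiv.Perm (Fin m) × (Fin m → Fin K)) ≠ (σB, lB) := by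
    intro h
    have hl : lA b = lB b := by rw [(Prod.mk.inj h).2]
    rw [hl] at hltb
    exact lt_irrefl _ hltb
  have hAB : θA ≠ θB := by
    rintro rfl
    exact lt_asymm (hA.2 _ (Ne.symm hABne) hB.1) (hB.2 _ hABne hA.1)
  exact core_law_budget d v ε hm hlC hCge hlowA hlowB hBA hdef hltb hA hB hC hAC hBC hAB
    (moved_special d v ε hA hB hAB hBA hltb hxb hdiff)

end Summit.ValiantsHypothesis.ValiantsHypothesis.Theorems.KPlusLogSqLaw.TopHeavyCore
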